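import Summits.CriticalPhenomena.PercolationContinuityZ3.Theorems.PercNearOneGluingNoHeavyQuantFarGate3PinchRAllS17
import Summits.CriticalPhenomena.PercolationContinuityZ3.Theorems.PercNearOneGluingNoHeavyQuantFarGate3PinchRAllS34
import HarnessLib

/-!
# QUANT lane R8, front "FAR beyond trees", layer one — THE DEGREE-THREE GATE AT THE OBSERVER: pinch chart R — SUB-MASTER `pinchR_all_s35`

builds on p205010 (kernel theorem, internal audit signed; external expert review pending)

Support file (`--supports stmt-CriticalPhenomena-4575`), seats `prim-quant-p1` gen 35/36; memos
`run/shared/lean/prim/quant/prim-quant-p1-g35/FOR-LEAD-GATE3-PINCH.md`, `…/prim-quant-p1-g36/FOR-LEAD-GATE3-PINCH2.md`.  Data files / sub-masters of chart R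
only; standard axioms; no sorries.  GENERATED by `dataN2/gen_master3.py`.

[this work].
-/

namespace Summit.CriticalPhenomena.PercolationContinuityZ3.Theorems

namespace Quant

set_option maxHeartbeats 800000 in
/-- Chart R has no bad point with `y ∈ [0, 1/8]`, `a ∈ [0, 1]`, `b ∈ [0, 1/4]`, `c ∈ [-1, 0]` (sub-master, dispatch along the k-d tree of file regions). [this work] -/
theorem pinchR_all_s35 : CertN.BoxOKR PinchR.spec (0 : ℝ) ((1 : ℝ) / 8) (0 : ℝ) (1 : ℝ) (0 : ℝ) ((1 : ℝ) / 4) (-1 : ℝ) (0 : ℝ) := by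
  intro y a b c hylo hyhi halo hahi hblo hbhi hclo hchi v
  rcases le_total y ((1 : ℝ) / 32) with hcut | hcut
  · exact pinchR_all_s17 y a b c (by linarith) (by linarith) (by linarith) (by linarith) (by linarith) (by linarith) (by linarith) (by linarith) v
  · exact pinchR_all_s34 y a b c (by linarith) (by linarith) (by linarith) (by linarith) (by linarith) (by linarith) (by linarith) (by linarith) v

end Quant

end Summit.CriticalPhenomena.PercolationContinuityZ3.Theorems
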